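import Summits.QuantumFields.YangMills.Theorems.UnitScaleTiltProp7In19DatumRows
import Summits.QuantumFields.YangMills.Theorems.UnitScaleTiltProp7Thm2GaugeCentreValues
import Summits.QuantumFields.YangMills.Theorems.UnitScaleTiltProp7CovOfThm2
import Summits.QuantumFields.YangMills.Theorems.UnitScaleTiltProp7LemmaHCurvedFramesOfRegPr
import Summits.QuantumFields.YangMills.Theorems.UnitScaleTiltProp7TwistRegauge
import HarnessLib

/-!
# Route `UnitScaleTilt`, crux K1 «MinimiserStabilityRegPr» (stmt-QuantumFields-19200), route-R E′ path (α′), (E1) — **THE THM-2 DATUM SOCKET OF THE (E1)-DOOR FROM THE EX KNIT'S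
# PRINT SOCKET `hThm2S`** (P3 of LOCATE «HDATUM-OF-THM2S»): at every member of record and every competitor `W′ ∈ (6)(e) ∩ 𝔅_k(V)`, [Balaban1985RegularSpaces] Thm 2 in the tree's
# interface currency `B8Thm2SetupTorus.Thm2SetupSUAt (F.P K) 2 (K−n) (eta F n K) β₀ B₁ B₂ c₁ len (fun _ => True)` (= S15ᴰ ✓p684527's `hThm2S` at this `L`) YIELDS the datum
# `∃ A₀ u Fr a₀ a₁, W′ = (e^{iA₀}W)^u ∧ A₀ Herm-tr0 ∧ ℓ‖A₀‖ ≤ 2B₁′e₆ ∧ ℓ²‖D*_𝒰A₀‖ ≤ 6B₁′e₆ ∧ dist1(u c_y) ≤ 240B₁′e₆ ∧ frames (ℓa₀, ℓ²a₁ ≤ c35a₅e^{c35a₅})` — the body of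
# ✓ `Prop7PinnedSliceRowOfThm2Datum.pinnedSliceRow_of_thm2Datum`'s `hDatum` with L-only constants

Cell `ym3-torus`, width seat `ym3-torus-px13` (gen 4); LOCATE «HDATUM-OF-THM2S» (19200 evidence n = 40, 2026-08-29).  THEOREMS ONLY (0 `def`, 0 `sorry`, 0 `instance`);
`--supports stmt-QuantumFields-19200`, count-neutral.  YM₃ on T³ is a ladder rung (R3), not the Clay problem; nothing here claims the stub, the crux, d = 4 or the gap; `hThm2S` is a
HYPOTHESIS SHAPE (lit-balaban's conditional supplier lineage A13–A15, ✓ `BalabanUVNodesN16Thm2SetupTorusOfCover.hThm2S_of_floorS`), not proved here.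

THE CHAIN (all by name).  `W, W′ ∈ regFibrePr(e, V)` ⇒ (a) axial representative `v` (`= 1` at every k-centre, `W′^v` based-axial): ✓ `Prop7AxialReprPrint.exists_repr_inAx_based` over
✓ `inAk_pull_of_regPr`; `W′^v ∈ (6)(e) ∩ 𝔅_k(V)`: ✓ `Prop7TwistRegauge.gaugeAct_mem_regFibrePr_of_centre_eq`.  (b) [Balaban1985Variational] Prop. 2 = COV from Thm 2:
✓ `Prop7CovOfThm2.cov_of_thm2SetupSUAt` (w1 g2) at `(U₀ := W, U := W′^v)`, `ε₀ := e`, `ε₁ := e∕L³`, `B₃ := 1`, `ε₂ := 2B₁′e` ⇒ `u U₁ X` with `RestrictedPrint W u`, `(U₁W)^u = W′^v`,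
`In19 F n K ε₂ W U₁ X`.  (c) ✓ `Prop7In19DatumRows.datumRows_of_in19` (P1): `U₁ = e^{iX}`, Herm-tr0, `ℓ‖X‖ ≤ ε₂`, `ℓ²‖D*_𝒰X‖ ≤ 3ε₂`.  (d) ✓ `Prop7Thm2GaugeCentreValues.dist1_centre_le_of_axial_restricted`
(P2, [Balaban1985RegularSpaces] (1.72) at the k-centres): `dist1 (u c_y) ≤ 120ε₂`.  (e) the door's gauge `x ↦ v(x)⁻¹u(x)` (`W′ = ((e^{iX}W)^u)^{v⁻¹}`, lit ✓ `gaugeAct_gaugeAct`; `v(c_y) = 1`).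
(f) frames ✓ `Prop7LemmaHCurvedFramesOfRegPr.exists_frames_T3_of_regPr` at `α₀ := e` (`(L·L^{a′})·e ≤ a₅`), `a₀ = ηC′e^{ηC′}`, `a₁ = η(ηC′)e^{ηC′}`, `C′ = c35·(L·L^{a′})·e ≤ c35a₅`.
(g) windows: the member's windows for (a), (d) follow from the displayed L-only windows at `e₆` by monotonicity (`e ≤ e₆`).

WHAT IS PROVED (ns `…Theorems.Prop7DatumOfThm2S`): ★★★ `hDatum_of_thm2S_member` — see the docstring.  AFTER THIS FILE the E1 side of the E′ display v5 (✓p684177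
`stub_PV3E_of_rawRows_twoSided`) reads, at members of record: `hDatum ⟸ hThm2S` (this file) and `hLrow ⟸ hKsup` (✓p684681) — ONE Thm-2 socket shared with EX, plus `hKsup`, the
member-of-record data (`a′`, `hsize`, `hM8`, `(L·L^{a′})e ≤ a₅`), and L-only windows.
HONEST SCOPE.  Composition of landed theorems; every analytic input is print's Thm 2 (HYPOTHESIS) or a landed theorem; constants generous (`40·3` for print's `16d`); small members not covered.

References: T. Bałaban, CMP 102 (1985) 277–309 [Balaban1985Variational] (Prop. 2 p.281, (13)–(19) pp.280–281, (4)–(6) p.278); CMP 99 (1985) 75–102 [Balaban1985RegularSpaces]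
(Thm 2 p.83, (1.19) p.79, (1.29) p.81, (1.33)–(1.36) p.82, (1.70)–(1.72) p.88); CMP 99 (1985) 389–434 [Balaban1985BackgroundPropagators] ((3.35) p.396, (3.8) p.392); CMP 98 (1985)
17–51 [Balaban1985Averaging] ((55) p.27, (78)–(81) p.30, (104)–(106) p.33, Prop. 2 p.26).
-/

set_option autoImplicit false

noncomputable section

open scoped BigOperators Matrix.Norms.L2Operator Matrix
open NormedSpace

namespace Summit.QuantumFields.YangMills.Theorems.Prop7DatumOfThm2S

open Literature.MathematicalPhysics.QuantumFieldTheory.Balaban1983to89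
open Literature.MathematicalPhysics.QuantumFieldTheory.Balaban1983to89.T3ContinuumYM3Torus
open Literature.MathematicalPhysics.QuantumFieldTheory.Balaban1983to89.T3PrintedRegularMinimiser (RegPr regFibrePr mem_regFibrePr_iff)
open Literature.MathematicalPhysics.QuantumFieldTheory.Balaban1983to89.T3SectALandauChart (emb15 eta eta_pos In19 CloseAvg closeAvg_of_mem_fibre)
open Literature.MathematicalPhysics.QuantumFieldTheory.Balaban1983to89.T3UnitLawGaugeInvariance (gaugeAct_gaugeAct)
open T4Continuum
open B7Prop1Explicit renaming Site → LSite
open B7Prop2Explicit (C0 c2' C0_pos c2'_pos)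
open B7Prop3Flat (c3)
open B8Thm4TorusAt (torusLam)
open B8Thm2SetupTorus (Thm2SetupSUAt)
open B9Eq39Adjoint (divB)
open B9TorusCalculus (torusT)
open B10Eq27TorusAxialLog (unitsField toUField)
open B5Eq118OneStroke (iterBlockOf)
open B15DeterminingSets (embIter)
open Summit.QuantumFields.YangMills.Theorems.Prop7TPrint (expHermField)
open Summit.QuantumFields.YangMills.Theorems.Prop7SPrint (IsAxialPrint RestrictedPrint)
open Summit.QuantumFields.YangMills.Theorems.Prop7AxialReprPrint (exists_repr_inAx_based inAk_pull_of_regPr)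
open Summit.QuantumFields.YangMills.Theorems.Prop7TwistRegauge (gaugeAct_mem_regFibrePr_of_centre_eq)
open Summit.QuantumFields.YangMills.Theorems.Prop7CovOfThm2 (cov_of_thm2SetupSUAt)
open Summit.QuantumFields.YangMills.Theorems.Prop7LemmaHCurvedFramesOfRegPr (exists_frames_T3_of_regPr)
open Summit.QuantumFields.YangMills.Theorems.Prop7In19DatumRows (datumRows_of_in19)
open Summit.QuantumFields.YangMills.Theorems.Prop7Thm2GaugeCentreValues (dist1_centre_le_of_axial_restricted)

/-- `gaugeAct 1 = id`. [cite: Balaban1985Averaging, (8) p.19] -/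
theorem gaugeAct_const_one {P : Params} (U : GaugeField P 0 (Matrix.specialUnitaryGroup (Fin 2) ℂ)) :
    GaugeField.gaugeAct (fun _ => (1 : Matrix.specialUnitaryGroup (Fin 2) ℂ)) U = U := by
  funext b; simp [GaugeField.gaugeAct]

/-- ★★★ **THE (E1)-DOOR'S THM-2 DATUM SOCKET FROM `hThm2S` AT MEMBERS OF RECORD.**  For odd `L = ℓ + 1 ≥ 5` and [6] Theorem 2 in `Thm2SetupSUAt` currency at every member of block size `L`
(the EX knit's `hThm2S` at this `L`, constants `B₁ c₁`): there are L-only `B₁′ c₁′ c35 a₅ > 0` such that for every `e₆ > 0` within the displayed windows (`2e₆ ≤ c₁′`; [Balaban1985Averaging] Prop. 2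
`C₀·2e₆ ≤ ⅓`, `8e₆ ≤ c₂′`; [6] p. 88 `hsmall`, `4B₁′e₆ ≤ c₃`, `768B₁′e₆ ≤ 1`), every member of record (`F.L = L`, `n < K`, `a′ + 3 ≤ F.m + n`, `8 ≤ L^{a′}`), every `0 < e ≤ e₆` with
`(L·L^{a′})·e ≤ a₅`, every fibre point `W ∈ (6)(e) ∩ 𝔅_k(V)` and every competitor `W′ ∈ (6)(e) ∩ 𝔅_k(V)`: the Thm-2 datum of ✓ `pinnedSliceRow_of_thm2Datum`'s `hDatum` holds with
`s₀ := 2B₁′e₆`, `s₁′ := 6B₁′e₆`, `σ := 240B₁′e₆`, `c₀ = c₁ := c35a₅e^{c35a₅}`.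
[cite: Balaban1985Variational, Prop. 2 p.281, (13)-(19) pp.280-281; Balaban1985RegularSpaces, Thm 2 p.83, (1.36) p.82, (1.72) p.88; Balaban1985BackgroundPropagators, (3.35) p.396] -/
theorem hDatum_of_thm2S_member {ℓ : ℕ} (hℓ4 : 4 ≤ ℓ) (hL : Odd (ℓ + 1) ∧ 1 < ℓ + 1) {B₁ c₁ : ℝ} (hB₁ : 0 < B₁) (hc₁ : 0 < c₁)
    (hThm2S : ∀ (F : T3Family), F.L = ℓ + 1 → ∀ (n K : ℕ), n < K →
      ∃ (β₀ B₂ : ℝ) (len : LSite (F.P K).d → ℝ), Thm2SetupSUAt (F.P K) 2 (K - n) (eta F n K) β₀ B₁ B₂ c₁ len (fun _ => True)) :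
    ∃ B₁' c₁' c35 a₅ : ℝ, 0 < B₁' ∧ 0 < c₁' ∧ 0 < c35 ∧ 0 < a₅ ∧
    ∀ (e₆ : ℝ), 0 < e₆ → 2 * e₆ ≤ c₁' →
      -- print's numeric windows at `e₆` (L-only)
      C0 3 * (2 * e₆) ≤ 1 / 3 → 8 * e₆ ≤ c2' 3 (ℓ + 1) →
      Real.exp (4 * (800 * ((3 : ℝ) + 1) ^ 2 * ((3 : ℝ) + 4)) * (2 * e₆)) * (1 + 8 * (131072 * ((3 : ℝ) + 1) ^ 2) * (2 * B₁' * e₆)) ≤ 2 →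
      2 * (2 * B₁' * e₆) ≤ c3 3 (ℓ + 1) → 128 * (3 : ℝ) * (2 * B₁' * e₆) ≤ 1 →
    ∀ (F : T3Family), F.L = ℓ + 1 → ∀ (n K a' : ℕ) (hnK : n < K), a' + 3 ≤ F.m + n → 8 ≤ (ℓ + 1) ^ a' →
    ∀ (e : ℝ) (V : GaugeField (F.P n) 0 (Matrix.specialUnitaryGroup (Fin 2) ℂ)) (W : GaugeField (F.P K) 0 (Matrix.specialUnitaryGroup (Fin 2) ℂ)),
      0 < e → e ≤ e₆ → ((ℓ + 1 : ℕ) : ℝ) * (((ℓ + 1) ^ a' : ℕ) : ℝ) * e ≤ a₅ → W ∈ regFibrePr F n K hnK.le e V →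
      ∀ W' : GaugeField (F.P K) 0 (Matrix.specialUnitaryGroup (Fin 2) ℂ), W' ∈ regFibrePr F n K hnK.le e V →
        ∃ (A₀ : PBond (F.P K) 0 → Matrix (Fin 2) (Fin 2) ℂ) (u : GaugeTransf (F.P K) 0 (Matrix.specialUnitaryGroup (Fin 2) ℂ))
          (Fr : Site (F.P K) (K - n) → Site (F.P K) 0 → (Matrix (Fin 2) (Fin 2) ℂ)ˣ) (a₀ a₁ : ℝ),
          W' = GaugeField.gaugeAct u (emb15 W (expHermField A₀)) ∧
          (∀ b, (A₀ b).IsHermitian ∧ Matrix.trace (A₀ b) = 0) ∧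
          ((((F.P K).L ^ (K - n) : ℕ)) : ℝ) * ‖(fun (μ : Fin (F.P K).d) (z : Site (F.P K) 0) => A₀ ⟨z, μ⟩)‖ ≤ 2 * B₁' * e₆ ∧
          ((((F.P K).L ^ (K - n) : ℕ)) : ℝ) ^ 2 * ‖(fun x => divB (torusT (F.P K) 0) (fun κ z => unitsField (toUField W) ⟨z, κ⟩) (fun μ z => A₀ ⟨z, μ⟩) x)‖ ≤ 6 * B₁' * e₆ ∧
          (∀ y : Site (F.P K) (K - n), dist1 (u (embIter (K - n) y)) ≤ 240 * B₁' * e₆) ∧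
          (∀ y z, ‖(Fr y z : Matrix (Fin 2) (Fin 2) ℂ)‖ ≤ 1 ∧ ‖(((Fr y z)⁻¹ : (Matrix (Fin 2) (Fin 2) ℂ)ˣ) : Matrix (Fin 2) (Fin 2) ℂ)‖ ≤ 1) ∧
          (∀ y, Fr y (embIter (K - n) y) = 1) ∧
          0 ≤ a₀ ∧ 0 ≤ a₁ ∧ ((((F.P K).L ^ (K - n) : ℕ)) : ℝ) * a₀ ≤ c35 * a₅ * Real.exp (c35 * a₅) ∧
          ((((F.P K).L ^ (K - n) : ℕ)) : ℝ) ^ 2 * a₁ ≤ c35 * a₅ * Real.exp (c35 * a₅) ∧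
          (∀ (y : Site (F.P K) (K - n)) (z : Site (F.P K) 0), (∀ ν : Fin (F.P K).d, (y ν = (iterBlockOf (K - n) (fun κ => z κ - (((((F.P K).L ^ (K - n) - 1) / 2 : ℕ)) : ZMod ((F.P K).sitesPerDir 0)))) ν - 1 ∨ y ν = (iterBlockOf (K - n) (fun κ => z κ - (((((F.P K).L ^ (K - n) - 1) / 2 : ℕ)) : ZMod ((F.P K).sitesPerDir 0)))) ν ∨ y ν = (iterBlockOf (K - n) (fun κ => z κ - (((((F.P K).L ^ (K - n) - 1) / 2 : ℕ)) : ZMod ((F.P K).sitesPerDir 0)))) ν + 1 ∨ y ν = (iterBlockOf (K - n) (fun κ => z κ - (((((F.P K).L ^ (K - n) - 1) / 2 : ℕ)) : ZMod ((F.P K).sitesPerDir 0)))) ν + 2)) → ∀ μ : Fin (F.P K).d,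
          ‖(((Fr y z)⁻¹ * unitsField (toUField W) ⟨z, μ⟩ * Fr y (torusT (F.P K) 0 μ z) : (Matrix (Fin 2) (Fin 2) ℂ)ˣ) : Matrix (Fin 2) (Fin 2) ℂ) - 1‖ ≤ a₀
          ∧ ‖(((Fr y ((torusT (F.P K) 0 μ).symm z))⁻¹ * unitsField (toUField W) ⟨(torusT (F.P K) 0 μ).symm z, μ⟩ * Fr y z : (Matrix (Fin 2) (Fin 2) ℂ)ˣ) : Matrix (Fin 2) (Fin 2) ℂ) - 1‖ ≤ a₀
          ∧ ‖(((Fr y z)⁻¹ * unitsField (toUField W) ⟨z, μ⟩ * Fr y (torusT (F.P K) 0 μ z) : (Matrix (Fin 2) (Fin 2) ℂ)ˣ) : Matrix (Fin 2) (Fin 2) ℂ)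
          - (((Fr y ((torusT (F.P K) 0 μ).symm z))⁻¹ * unitsField (toUField W) ⟨(torusT (F.P K) 0 μ).symm z, μ⟩ * Fr y z : (Matrix (Fin 2) (Fin 2) ℂ)ˣ) : Matrix (Fin 2) (Fin 2) ℂ)‖ ≤ a₁) := by
  obtain ⟨B₁', c₁', hB₁', hc₁', HCOV⟩ := cov_of_thm2SetupSUAt (L := ℓ + 1) (B₃ := 1) zero_le_one hB₁ hc₁ hThm2S
  obtain ⟨c35, a₅, hc35, ha₅, HFR⟩ := exists_frames_T3_of_regPr (hL := hL) hℓ4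
  refine ⟨B₁', c₁', c35, a₅, hB₁', hc₁', hc35, ha₅, ?_⟩
  intro e₆ he₆ h2e₆ hw1 hw2 hw3 hw4 hw5 F hF n K a' hnK hsize hM8 e V W he hee hMα hW W' hW'
  -- the member of record IS `⟨ℓ+1, hL, m, hm⟩`
  obtain ⟨L', hL', m, hm⟩ := F
  change L' = ℓ + 1 at hF
  subst hF
  have hk1 : 1 ≤ K - n := by omega
  have hk : K - n ≤ ((⟨ℓ + 1, hL', m, hm⟩ : T3Family).P K).m + ((⟨ℓ + 1, hL', m, hm⟩ : T3Family).P K).K := by show K - n ≤ m + K; omega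
  change a' + 3 ≤ m + n at hsize
  -- membership data of the two fibre points
  have hfibW := ((mem_regFibrePr_iff (⟨ℓ + 1, hL', m, hm⟩ : T3Family)).1 hW).1
  have hregW : RegPr (⟨ℓ + 1, hL', m, hm⟩ : T3Family) n K e W := ((mem_regFibrePr_iff (⟨ℓ + 1, hL', m, hm⟩ : T3Family)).1 hW).2
  have hregW' : RegPr (⟨ℓ + 1, hL', m, hm⟩ : T3Family) n K e W' := ((mem_regFibrePr_iff (⟨ℓ + 1, hL', m, hm⟩ : T3Family)).1 hW').2
  -- the member's windows from the displayed ones at `e₆`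
  have hC0 : 0 < C0 3 := C0_pos 3
  have hB2e : 0 ≤ 2 * B₁' * e := by positivity
  have hcmono : 2 * B₁' * e ≤ 2 * B₁' * e₆ := by nlinarith
  have hα3 : C0 3 * (2 * e) ≤ 1 / 3 := le_trans (by nlinarith) hw1
  have hα2 : 2 * (2 * e) ≤ c2' 3 (ℓ + 1) := by linarith
  have hα4 : 4 * (2 * e) ≤ c2' 3 (ℓ + 1) := by linarith
  have hsmall : Real.exp (4 * (800 * ((3 : ℝ) + 1) ^ 2 * ((3 : ℝ) + 4)) * (2 * e)) * (1 + 8 * (131072 * ((3 : ℝ) + 1) ^ 2) * (2 * B₁' * e)) ≤ 2 := by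
    refine le_trans ?_ hw3
    gcongr
  have hc₃ : 2 * (2 * B₁' * e) ≤ c3 3 (ℓ + 1) := by linarith
  have hs : 128 * (3 : ℝ) * (2 * B₁' * e) ≤ 1 := by linarith
  -- (a) the axial representative `W′^v`, `v = 1` at the k-centres
  obtain ⟨v, hv1, hvax⟩ := exists_repr_inAx_based (P := (⟨ℓ + 1, hL', m, hm⟩ : T3Family).P K) (by norm_num : (2 : ℕ) ≤ 21) hk he hα3 hα2 W W'
    (inAk_pull_of_regPr (⟨ℓ + 1, hL', m, hm⟩ : T3Family) he.le hregW) (inAk_pull_of_regPr (⟨ℓ + 1, hL', m, hm⟩ : T3Family) he.le hregW')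
  have haxv : IsAxialPrint (⟨ℓ + 1, hL', m, hm⟩ : T3Family) n K W (GaugeField.gaugeAct v W') := hvax (torusLam (K - n))
  have hWv : GaugeField.gaugeAct v W' ∈ regFibrePr (⟨ℓ + 1, hL', m, hm⟩ : T3Family) n K hnK.le e V :=
    gaugeAct_mem_regFibrePr_of_centre_eq (⟨ℓ + 1, hL', m, hm⟩ : T3Family) hnK.le he.le (g := v) (u := fun _ => 1) (fun y => by rw [hv1 y])
      (X := W') (V := V) (by rw [gaugeAct_const_one]; exact hW')
  -- (b) COV = [Balaban1985Variational] Prop. 2 from Thm 2, at `(W, W′^v)`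
  have hL0 : (0 : ℝ) < ((ℓ + 1 : ℕ) : ℝ) := by positivity
  have hL3 : (0 : ℝ) < ((ℓ + 1 : ℕ) : ℝ) ^ 3 := by positivity
  have hε₁ : 0 < e / ((ℓ + 1 : ℕ) : ℝ) ^ 3 := by positivity
  have hprod : ((ℓ + 1 : ℕ) : ℝ) ^ 3 * (e / ((ℓ + 1 : ℕ) : ℝ) ^ 3) = e := by field_simp
  have hreg3 : RegPr (⟨ℓ + 1, hL', m, hm⟩ : T3Family) n K (((ℓ + 1 : ℕ) : ℝ) ^ 3 * 1 * (e / ((ℓ + 1 : ℕ) : ℝ) ^ 3)) W := by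
    rw [mul_one, hprod]; exact hregW
  have hclose : CloseAvg (⟨ℓ + 1, hL', m, hm⟩ : T3Family) n K hnK.le (((ℓ + 1 : ℕ) : ℝ) ^ 3 * (e / ((ℓ + 1 : ℕ) : ℝ) ^ 3)) V W :=
    closeAvg_of_mem_fibre (by positivity) hfibW
  have hsum : e + ((ℓ + 1 : ℕ) : ℝ) ^ 3 * (e / ((ℓ + 1 : ℕ) : ℝ) ^ 3) = 2 * e := by rw [hprod]; ring
  obtain ⟨u, U₁, X, h129, hgauge, h19, -, -⟩ := HCOV ⟨ℓ + 1, hL', m, hm⟩ rfl n K hnK e (e / ((ℓ + 1 : ℕ) : ℝ) ^ 3) (2 * B₁' * e) he hε₁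
    (by rw [hsum]; linarith) (by rw [hsum]; linarith) V W hreg3 hclose (GaugeField.gaugeAct v W') hWv haxv
  -- (c) (19) in the door's currency
  obtain ⟨hU₁, hA0, hs₀, -, hs₁⟩ := datumRows_of_in19 W U₁ X h19
  -- (d) (1.72) at the k-centres
  have hXc : ∀ b : PBond ((⟨ℓ + 1, hL', m, hm⟩ : T3Family).P K) 0, ‖X b‖ ≤ 2 * B₁' * e * eta (⟨ℓ + 1, hL', m, hm⟩ : T3Family) n K :=
    fun b => (h19.2.2.1 b).le
  have haxu : IsAxialPrint (⟨ℓ + 1, hL', m, hm⟩ : T3Family) n K W (GaugeField.gaugeAct u (emb15 W U₁)) := by rw [hgauge]; exact haxv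
  have hσ : ∀ y, dist1 (u (embIter (K - n) y)) ≤ 40 * 3 * (2 * B₁' * e) := fun y =>
    dist1_centre_le_of_axial_restricted (⟨ℓ + 1, hL', m, hm⟩ : T3Family) hnK.le he hB2e W hregW u U₁ X haxu h129 h19.2.1 hXc hα3 hα4 hsmall hc₃ hs y
  -- (f) the frames
  obtain ⟨Fr, hFr, hFr1, hA⟩ := HFR hℓ4 m hm n K a' (2 * (ℓ + 1) ^ 2) hk1 hsize hM8 le_rfl e he hMα W hregW
  -- constants of the frames
  have hη1 : ((((ℓ + 1 : ℕ) : ℝ)) ^ (K - n))⁻¹ ≤ 1 := inv_le_one_of_one_le₀ (one_le_pow₀ (by exact_mod_cast (by omega : 1 ≤ ℓ + 1)))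
  have hη0 : 0 < ((((ℓ + 1 : ℕ) : ℝ)) ^ (K - n))⁻¹ := by positivity
  have hC' : c35 * (((ℓ + 1 : ℕ) : ℝ) * (((ℓ + 1) ^ a' : ℕ) : ℝ)) * e ≤ c35 * a₅ := by
    have := mul_le_mul_of_nonneg_left hMα hc35.le
    linarith [this]
  have hC'0 : 0 ≤ c35 * (((ℓ + 1 : ℕ) : ℝ) * (((ℓ + 1) ^ a' : ℕ) : ℝ)) * e := by positivity
  have hexp : Real.exp (((((ℓ + 1 : ℕ) : ℝ)) ^ (K - n))⁻¹ * (c35 * (((ℓ + 1 : ℕ) : ℝ) * (((ℓ + 1) ^ a' : ℕ) : ℝ)) * e)) ≤ Real.exp (c35 * a₅) := by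
    apply Real.exp_le_exp.2
    calc ((((ℓ + 1 : ℕ) : ℝ)) ^ (K - n))⁻¹ * (c35 * (((ℓ + 1 : ℕ) : ℝ) * (((ℓ + 1) ^ a' : ℕ) : ℝ)) * e)
        ≤ 1 * (c35 * (((ℓ + 1 : ℕ) : ℝ) * (((ℓ + 1) ^ a' : ℕ) : ℝ)) * e) := mul_le_mul_of_nonneg_right hη1 hC'0
      _ ≤ c35 * a₅ := by rw [one_mul]; exact hC'
  have hblock : (((((⟨ℓ + 1, hL', m, hm⟩ : T3Family).P K).L ^ (K - n) : ℕ)) : ℝ) = (((ℓ + 1 : ℕ) : ℝ)) ^ (K - n) := by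
    rw [Nat.cast_pow]; rfl
  have hmain : (((ℓ + 1 : ℕ) : ℝ)) ^ (K - n) * (((((ℓ + 1 : ℕ) : ℝ)) ^ (K - n))⁻¹ * (c35 * (((ℓ + 1 : ℕ) : ℝ) * (((ℓ + 1) ^ a' : ℕ) : ℝ)) * e)
      * Real.exp (((((ℓ + 1 : ℕ) : ℝ)) ^ (K - n))⁻¹ * (c35 * (((ℓ + 1 : ℕ) : ℝ) * (((ℓ + 1) ^ a' : ℕ) : ℝ)) * e))) ≤ c35 * a₅ * Real.exp (c35 * a₅) := by
    have hpow : (0 : ℝ) < (((ℓ + 1 : ℕ) : ℝ)) ^ (K - n) := by positivity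
    calc (((ℓ + 1 : ℕ) : ℝ)) ^ (K - n) * (((((ℓ + 1 : ℕ) : ℝ)) ^ (K - n))⁻¹ * (c35 * (((ℓ + 1 : ℕ) : ℝ) * (((ℓ + 1) ^ a' : ℕ) : ℝ)) * e)
          * Real.exp (((((ℓ + 1 : ℕ) : ℝ)) ^ (K - n))⁻¹ * (c35 * (((ℓ + 1 : ℕ) : ℝ) * (((ℓ + 1) ^ a' : ℕ) : ℝ)) * e)))
        = (c35 * (((ℓ + 1 : ℕ) : ℝ) * (((ℓ + 1) ^ a' : ℕ) : ℝ)) * e)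
          * Real.exp (((((ℓ + 1 : ℕ) : ℝ)) ^ (K - n))⁻¹ * (c35 * (((ℓ + 1 : ℕ) : ℝ) * (((ℓ + 1) ^ a' : ℕ) : ℝ)) * e)) := by
            field_simp
      _ ≤ c35 * a₅ * Real.exp (c35 * a₅) := mul_le_mul hC' hexp (Real.exp_pos _).le (by positivity)
  -- assemble the datum
  refine ⟨X, fun x => (v x)⁻¹ * u x, Fr, _, _, ?_, hA0, ?_, ?_, ?_, hFr, hFr1, ?_, ?_, ?_, ?_, hA⟩
  · -- `W′ = ((e^{iX}W)^u)^{v⁻¹}`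
    rw [← hU₁]
    have h1 : GaugeField.gaugeAct (fun x => (v x)⁻¹ * u x) (emb15 W U₁) = GaugeField.gaugeAct (fun x => (v x)⁻¹) (GaugeField.gaugeAct u (emb15 W U₁)) :=
      (gaugeAct_gaugeAct _ _ _).symm
    have h2 : (fun x => (v x)⁻¹ * v x) = fun _ => (1 : Matrix.specialUnitaryGroup (Fin 2) ℂ) := funext fun x => inv_mul_cancel _
    rw [h1, hgauge, gaugeAct_gaugeAct, h2, gaugeAct_const_one]
  · exact hs₀.trans hcmono
  · linarith [hs₁]
  · intro y
    show dist1 ((v (embIter (K - n) y))⁻¹ * u (embIter (K - n) y)) ≤ 240 * B₁' * e₆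
    rw [hv1 y, inv_one, one_mul]
    linarith [hσ y]
  · positivity
  · positivity
  · rw [hblock]; exact hmain
  · rw [hblock]
    have hpow : (0 : ℝ) < (((ℓ + 1 : ℕ) : ℝ)) ^ (K - n) := by positivity
    calc ((((ℓ + 1 : ℕ) : ℝ)) ^ (K - n)) ^ 2 * (((((ℓ + 1 : ℕ) : ℝ)) ^ (K - n))⁻¹ * (((((ℓ + 1 : ℕ) : ℝ)) ^ (K - n))⁻¹ * (c35 * (((ℓ + 1 : ℕ) : ℝ) * (((ℓ + 1) ^ a' : ℕ) : ℝ)) * e))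
          * Real.exp (((((ℓ + 1 : ℕ) : ℝ)) ^ (K - n))⁻¹ * (c35 * (((ℓ + 1 : ℕ) : ℝ) * (((ℓ + 1) ^ a' : ℕ) : ℝ)) * e)))
        = (((ℓ + 1 : ℕ) : ℝ)) ^ (K - n) * (((((ℓ + 1 : ℕ) : ℝ)) ^ (K - n))⁻¹ * (c35 * (((ℓ + 1 : ℕ) : ℝ) * (((ℓ + 1) ^ a' : ℕ) : ℝ)) * e)
          * Real.exp (((((ℓ + 1 : ℕ) : ℝ)) ^ (K - n))⁻¹ * (c35 * (((ℓ + 1 : ℕ) : ℝ) * (((ℓ + 1) ^ a' : ℕ) : ℝ)) * e))) := by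
            field_simp
      _ ≤ c35 * a₅ * Real.exp (c35 * a₅) := hmain

end Summit.QuantumFields.YangMills.Theorems.Prop7DatumOfThm2S

end
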